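import Literature.MathematicalPhysics.QuantumFieldTheory.Balaban1983to89.B6Ineq190GradTwoScaleV1

/-!
# `Balaban1983to89.B6Prop25GlobalGradL2TwoScaleV1` — T. Bałaban, *Propagators and renormalization transformations for lattice gauge theories. II*,
# Commun. Math. Phys. **96** (1984) 223–250 [Balaban1984PropagatorsII], PROPOSITION 2.5 p. 246, THE GLOBAL `L²` MEMBERS `‖∇GJ‖`, `‖G∇*J‖`,
# `‖∇G∇*J‖` OF [4] (1.89)/(1.115) AND THE LOWER BOUND (1.90) `Δ_a ≥ γ(Δ + I)` FOR THE GENUINE TWO-SCALE `G = Δ_a⁻¹` OF (2.90) (data `tsV1`,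
# `Λ′ ⊂ T^{(j+1)}` arbitrary, scaling `c = L^j`) — file 17 of the two-level programme: the energy route

statement-level skeleton of published theorems with citation tags; proofs where landed; nothing here is a claim about the Yang–Mills mass gap

PRINT (verbatim).  [B6] p. 246, Proposition 2.5: *"The operator G_□ defined by (2.90) on the torus T_□ (or on the whole lattice ξZ^d) has the
representation (2.129) and satisfies all the inequalities (1.110)–(1.114) of the Proposition 1.2 with a positive constant δ₂ instead of δ₀. This
constant depends on d and L only."*  [4] = [Balaban1984PropagatorsI] p. 36 [PDF 20]: *"The localized inequalities (1.110)–(1.114) imply immediately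
the following global inequalities … (1.115) … (1.117) and (1.89), with the same dependence of the constants O(1)."*  [4] p. 33 [PDF 17], Prop. 1.1:
*"The operator G is a symmetric operator on L²(T_η) and ‖GJ‖, ‖∇GJ‖, ‖G∇*J‖, ‖∇G∇*J‖, ‖∇∇GJ‖, ‖G∇*∇*J‖ ≤ γ₀⁻¹‖J‖, (1.89) with a positive constant
γ₀ independent of k, T_η, and depending on d only (if we put a = 1). This implies the bound from below: Δ_a = G⁻¹ ≥ γ₀(Δ + I). (1.90)"*.

WHAT THIS FILE DOES.  For the concrete two-scale `G = Δ_a⁻¹` of (2.90) (`…B6SectCTwoScaleV1Lattice.tsV1` at `c = η⁻¹ = L^j`, weights `a ≥ a₀n^{d+1}`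
on `𝔅`, `n = L^j`) it proves the second, third and fourth members of (1.89) — `‖∇_μGJ‖, ‖G∇_λ*J‖, ‖∇_μG∇_λ*J‖ ≤ C(d, L, a₀)‖J‖` — with NO dependence on
the volume, on `j`, on `Λ′` (the first member `‖GJ‖` is gen 13's `…B6Prop25BoundedTwoScaleV1`), and the printed consequence (1.90) for the two-scale
`Δ_a`.  Route (ours; the print's "imply immediately" goes through the localized kernel bounds, whose two-derivative members are not yet in the tree):
the operator identity (2.129) AS A FORM at the vector `u = ∇_λ*J` (file 16's `…B6Ineq190GradTwoScaleV1.inner_G_le_of_bounds_at`), where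
`H′_j*∂*∇_λ* = (∇_λ∂H′_j)*`, `H_j*∇_λ* = (∇_λH_j)*` are adjoints of operators whose KERNELS are bounded in the tree (files 8/9 of this programme:
`abs_DgradHp_entry_le`, `abs_DHj_entry_le`; Schur: `…B6SchurTorusBound.norm_sq_le_of_entry_decay` — §4 **`norm_DgradHp_sq_le`**, **`norm_DHj_sq_le`**:
`‖∇_λ∂H′_j‖², ‖∇_λH_j‖² = O(n^{d+1})`, against `C^{(j)}_Λ, C̃^{(j)}_Λ = O(n^{−(d+1)})`), and file 16's `⟨∇_λ*J, G̃_j∇_λ*J⟩ ≤ γ₀⁻¹‖J‖²` ([4] (1.90) with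
its gradient term for `M_j` on `{Q_jA = 0}`).  Results: **`prop25_inner_GDadj_le_V1`** (`⟨∇_λ*J, G∇_λ*J⟩ ≤ C₁(d, L, a₀)‖J‖²`, constant displayed);
**`prop25_grad_l2_bounded_uniform`** (`∃ C ∀ volume, j, Λ′, weights ≥ a₀n^{d+1}, λ, μ, J: ⟨J, GJ⟩ ≤ C‖J‖² ∧ ⟨∇_λ*J, G∇_λ*J⟩ ≤ C‖J‖² ∧ ‖∇_μG∇_λ*J‖ ≤
C‖J‖ ∧ ‖∇_μGJ‖ ≤ C‖J‖ ∧ ‖G∇_λ*J‖ ≤ C‖J‖` — the quantifier order IS the uniformity), by Cauchy–Schwarz for the non-negative symmetric form of `G`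
(file 16's `norm_sq_apply_le_of_forms`); **`prop25_ineq190_uniform`**: with the same `C`, `‖∇_μA‖² ≤ C⟨A, Δ_aA⟩` and `‖A‖² ≤ C⟨A, Δ_aA⟩` for every
`A` — the two-scale (1.90) (`A = G(Δ_aA)` and Cauchy–Schwarz for the form of `G`).

HONEST SCOPE / DIVERGENCES. (1) GLOBAL `ℓ²` bounds only (no `ζ`, no decay factor): of (1.89) the members 1–4 and (1.90) with `Δ` read as
`∇_μ*∇_μ` one direction at a time (summing over `μ` costs a factor `d + 1`); members 5–6 of (1.89) (`‖∇∇GJ‖`, `‖G∇*∇*J‖`) and the localized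
two-derivative members of (1.114) are NOT treated. (2) `∇_λ = n(S_λ − I)` componentwise on fine bond fields, `∇_λ*` its `ℓ²`-adjoint
`n(S_λ⁻¹ − I)` (file 12's `adjoint_Dop`); the printed `∇G∇*J` for a tensor source is the `(μ, λ)` matrix of these. (3) Torus case of (2.90), finite tori
`⟨d + 1, L, m, K, _, _⟩`, `[NeZero L]`, `c = L^j`, weights `a ≥ a₀n^{d+1}` ([4]'s `a ≥ a₀`); constants ours and crude, depending on `(d, L, a₀)` only.
(4) No definition, no new hypothesis; everything imported BY NAME.  NOT summit progress.  Unit `lit-balaban-p22` (gen 15), 2026-08-22.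
-/

noncomputable section

open scoped InnerProductSpace BigOperators Matrix
open Finset

namespace Literature.MathematicalPhysics.QuantumFieldTheory.Balaban1983to89.B6Prop25GlobalGradL2TwoScaleV1

open LatticeFieldCalculus B5SectBStatements B5Eq117TorusCarriers B6SectADomainsV1 B6SectAOperatorsV1 B6SectAVectorModelV1 B6SectCOperators
  B6SectCOperators.TwoScaleData B6SectCTwoScaleV1 B6SectCTwoScaleV1Lattice B6CovarianceOperator
open BalabanImbrieJaffe1984to88.BIJ85AxialPropagator411 (BondSpace)
open B4TorusKernel (periodConst)
open B4TorusKernel.MultiPeriod (torusSupNorm)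
open B4Sect5Proof (latticeConst latticeConst_nonneg)
open B5Prop11Lattice (gammaZero gammaZero_pos)
open B5Hk163Decay (MG163 MG163_nonneg)
open B5Hk163Strip (kappaN kappaN_pos kappa163 kappa163_pos)
open B5Hk163TorusHolderDecay (CdecD CdecD_nonneg)
open B5Kernel166Decay (periodConst_pos)
open B6Hprime2132Holder (MGHD)
open B6BlockDecayHprimeCovV1 (MGHD_nonneg)
open B5Eq118OneStroke (iterBlockOf)
open B6Hprime2101 (c0_2109 c0_2109_pos)
open B6LowerBound2153Torus (rep)
open B6SchurTorusBound (norm_sq_le_of_entry_decay)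
open B6HprimeOpNormV1 (card_filter_eq_le_one norm_dE_lapE_hP_sq_le)
open B6HjGtOpNormV1 (norm_le_of_form_le norm_adjoint_le norm_Hj_sq_le inner_Gt_le card_filter_src_le)
open B6SectCPositivity (G_symm G_comp_deltaA deltaA_pos)
open B6Cov2110TwoScaleV1 (inner_C_le_V1')
open B6Ineq2122TwoScaleV1 (inner_Ct_le_V1)
open B6BlockDecayHjCovV1 (card_fiber_src_iterBlockOf_le card_fiber_src_le)
open B6BlockDecayGradFactorsV1 (abs_DgradHp_entry_le abs_DHj_entry_le)
open B6BlockDecayGDivBridgeV1 (adjoint_Dop)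
open B6Prop25BoundedTwoScaleV1 (dv_eq_adjoint_grad inner_G_nonneg prop25_inner_G_le_V1)
open B6Ineq190GradTwoScaleV1 (norm_sq_apply_le_of_forms inner_Gt_Dadj_le inner_G_le_of_bounds_at)
open B6HjGtOpNormV1 (inner_sq_le_of_symm_nonneg)

/-! ## §4  The concrete two-scale data at `c = η⁻¹ = L^j`, weights `a ≥ a₀·n^{d+1}` -/

/-! ### Local notation (hygiene off: `d L m K hd hL j` are resolved at each use site) -/

set_option hygiene false in
/-- the parameter set `(d + 1, L, m, K)`. -/
local notation "P₀" => (⟨d + 1, L, m, K, hd, hL⟩ : Params)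

set_option hygiene false in
/-- the forward difference `∇_λ = n(S_λ − I)` on fine bond fields, `n = L^j`. -/
local notation "Df[" lam "]" => ((((L : ℝ) ^ j) • (onE (LinearMap.funLeft ℝ ℝ (fun b : PBond (⟨d + 1, L, m, K, hd, hL⟩ : Params) 0 =>
    (⟨b.src.shift lam, b.dir⟩ : PBond (⟨d + 1, L, m, K, hd, hL⟩ : Params) 0))) - LinearMap.id) :
      BondSpace (⟨d + 1, L, m, K, hd, hL⟩ : Params) →ₗ[ℝ] BondSpace (⟨d + 1, L, m, K, hd, hL⟩ : Params)))

set_option hygiene false in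
/-- its `ℓ²`-adjoint `∇_λ* = n(S_λ⁻¹ − I)` (file 12's `adjoint_Dop`). -/
local notation "Db[" lam "]" => ((((L : ℝ) ^ j) • (onE (LinearMap.funLeft ℝ ℝ (fun b : PBond (⟨d + 1, L, m, K, hd, hL⟩ : Params) 0 =>
    (⟨b.src.unshift lam, b.dir⟩ : PBond (⟨d + 1, L, m, K, hd, hL⟩ : Params) 0))) - LinearMap.id) :
      BondSpace (⟨d + 1, L, m, K, hd, hL⟩ : Params) →ₗ[ℝ] BondSpace (⟨d + 1, L, m, K, hd, hL⟩ : Params)))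

set_option hygiene false in
/-- `A_m = MGHD(d+1,m)·periodConst(κ_N(d+1),d)·latticeConst(d+1)(κ_N(d+1)/(d+1))`, r03's `H′_j` kernel constants times the lattice sum. -/
local notation "AN[" mo "]" => (MGHD (d + 1) mo * periodConst (kappaN (d + 1)) d * latticeConst (d + 1) (kappaN (d + 1) / (d + 1)))

set_option hygiene false in
/-- `A_H = MG163(d+1)·periodConst(κ₁₆₃(d+1),d)·latticeConst(d+1)(κ₁₆₃(d+1)/(d+1))`, b05's `H_k` kernel constant times the lattice sum. -/
local notation "AH₀" => (MG163 (d + 1) * periodConst (kappa163 (d + 1)) d * latticeConst (d + 1) (kappa163 (d + 1) / (d + 1)))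

set_option hygiene false in
/-- `A_D = CdecD(d)·latticeConst(d+1)(κ₁₆₃(d+1)/(d+1))`, b05's `∂H_k` kernel constant times the lattice sum. -/
local notation "AD₀" => (CdecD d * latticeConst (d + 1) (kappa163 (d + 1) / (d + 1)))

set_option hygiene false in
/-- `q = c₀(d+1)(8/L²)²` of (2.109). -/
local notation "q₀" => (c0_2109 (d + 1) * (8 / (L : ℝ) ^ 2) ^ 2)

set_option hygiene false in
/-- `Γ = (481(d+1)⁶L^{2(d+1)+4})⁻¹` of (2.122). -/
local notation "Γ₀" => (481 * (d + 1 : ℝ) ^ 6 * (L : ℝ) ^ (2 * (d + 1) + 4))⁻¹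

section Concrete

variable {d L m K : ℕ} [NeZero L] {hd : 1 ≤ d + 1} {hL : Odd L ∧ 1 < L} {j : ℕ} (hc : ((L : ℝ) ^ j) ≠ 0)
  (hj : j + 1 ≤ (⟨d + 1, L, m, K, hd, hL⟩ : Params).m + (⟨d + 1, L, m, K, hd, hL⟩ : Params).K)
  (Λ' : Finset (Site (⟨d + 1, L, m, K, hd, hL⟩ : Params) (j + 1))) {w : CIdx j Λ' → ℝ}

include hj in
/-- **`‖∇_λ∂H′_jμ‖² ≤ (d+1)·A₂²·n^{d+1}·‖μ‖²`** at `c = L^j` (file 8's entry decay `abs_DgradHp_entry_le` and the rectangular Schur test; rows = fine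
bonds ↦ unit block of the initial point, `≤ (d+1)n^{d+1}` each; columns = unit sites).
[cite: Balaban1984PropagatorsII, p.246 (text after (2.132): «derivatives of H′_j up to third order … uniformly bounded»)] -/
theorem norm_DgradHp_sq_le (lam : Fin (d + 1)) (μ : USite P₀ j) :
    ‖(Df[lam] ∘ₗ ((tsV1 hc Λ' w).grad ∘ₗ (tsV1 hc Λ' w).hP)) μ‖ ^ 2 ≤ (d + 1 : ℝ) * (AN[2] ^ 2 * ((L : ℝ) ^ j) ^ (d + 1) * ‖μ‖ ^ 2) := by
  classical
  have hj' : j ≤ (P₀).m + (P₀).K := Nat.le_of_succ_le hj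
  have hLj : (0 : ℝ) < (L : ℝ) ^ j := pow_pos (Nat.cast_pos.2 (Nat.pos_of_ne_zero (NeZero.ne L))) _
  have ha : 0 < kappaN (d + 1) / ((d : ℝ) + 1) := div_pos (kappaN_pos _) (by positivity)
  have hA : 0 ≤ |(L : ℝ) ^ j| / (L : ℝ) ^ j * (MGHD (d + 1) 2 * periodConst (kappaN (d + 1)) d) :=
    mul_nonneg (div_nonneg (abs_nonneg _) hLj.le) (mul_nonneg (MGHD_nonneg _ _) (periodConst_pos (kappaN_pos _) _).le)
  have h := norm_sq_le_of_entry_decay (Mk P₀ j) (Df[lam] ∘ₗ ((tsV1 hc Λ' w).grad ∘ₗ (tsV1 hc Λ' w).hP))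
    (fun b₀ : PBond P₀ 0 => iterBlockOf j b₀.src) (fun y : Site P₀ j => y)
    (card_fiber_src_iterBlockOf_le (P := P₀) hj') (card_filter_eq_le_one (P := P₀) (j := j)) hA ha
    (fun b₀ y => abs_DgradHp_entry_le hc hj' Λ' w lam y b₀) μ
  rw [abs_of_pos hLj, div_self hc, one_mul] at h
  refine h.trans (le_of_eq ?_)
  push_cast
  ring

section WithHw

variable (hw : ∀ i, 0 < w i)

include hj hw in
/-- **`‖∇_λH_jB‖² ≤ ((d+1)·A_D)²·n^{d+1}·‖B‖²`** (file 9's entry decay `abs_DHj_entry_le`, b05's `∂H_k` kernel, and the rectangular Schur test).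
[cite: Balaban1984PropagatorsI, p.29 lines 1–2; Balaban1984PropagatorsII, (2.130) p.246] -/
theorem norm_DHj_sq_le (lam : Fin (d + 1)) (b : UBond P₀ j) :
    ‖(Df[lam] ∘ₗ (tsV1 hc Λ' w).Hj) b‖ ^ 2 ≤ ((d + 1 : ℝ) * AD₀) ^ 2 * ((L : ℝ) ^ j) ^ (d + 1) * ‖b‖ ^ 2 := by
  classical
  have hj' : j ≤ (P₀).m + (P₀).K := Nat.le_of_succ_le hj
  have ha : 0 < kappa163 (d + 1) / ((d : ℝ) + 1) := div_pos (kappa163_pos _) (by positivity)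
  have h := norm_sq_le_of_entry_decay (Mk P₀ j) (Df[lam] ∘ₗ (tsV1 hc Λ' w).Hj)
    (fun b₀ : PBond P₀ 0 => iterBlockOf j b₀.src) (fun b : PBond P₀ j => b.src)
    (card_fiber_src_iterBlockOf_le (P := P₀) hj') (card_fiber_src_le (P := P₀) (j := j)) (CdecD_nonneg (d := d)) ha
    (fun b₀ b => abs_DHj_entry_le hc hj Λ' hw lam b₀ b) b
  refine h.trans (le_of_eq ?_)
  push_cast
  ring

end WithHw

variable {a₀ : ℝ} (ha₀ : 0 < a₀) (hw0 : ∀ i, a₀ * ((L : ℝ) ^ j) ^ (d + 1) ≤ w i)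

set_option maxHeartbeats 400000 in
include hj ha₀ hw0 in
/-- **PROPOSITION 2.5, THE `∇G∇*` MEMBER OF (1.89) AS A FORM, AT TWO LEVELS, FOR THE CONCRETE DATA**: at `c = η⁻¹ = L^j`, weights `a ≥ a₀n^{d+1}`,
**`⟨∇_λ*J, G∇_λ*J⟩ ≤ C₁(d, L, a₀)·‖J‖²`** for every direction `λ` and every `J`, with
`C₁ = (d+1)A₂²/q + 2(γ₀⁻¹ + (d+1)²A_D²/(min(a₀,1)Γ)) + 2(γ₀⁻¹ + (d+1)²A_H²/(min(a₀,1)Γ))((d+1)²A₃A₂/q)²` — NO dependence on the volume `(m, K)`,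
on `j`, or on `Λ′`: every power of `n` cancels. [cite: Balaban1984PropagatorsII, Prop. 2.5 p.246; Balaban1984PropagatorsI, (1.89) p.33, p.36 (text after (1.117))] -/
theorem prop25_inner_GDadj_le_V1 (lam : Fin (d + 1)) (J : BondSpace P₀) :
    ⟪Db[lam] J, (tsV1 hc Λ' w).G (Db[lam] J)⟫_ℝ ≤
      (q₀⁻¹ * ((d + 1 : ℝ) * AN[2] ^ 2) + 2 * ((gammaZero (d + 1) 1)⁻¹ + (min a₀ 1 * Γ₀)⁻¹ * ((d + 1 : ℝ) * AD₀) ^ 2) +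
        2 * ((gammaZero (d + 1) 1)⁻¹ + ((d + 1 : ℝ) * AH₀) ^ 2 * (min a₀ 1 * Γ₀)⁻¹) * ((d + 1 : ℝ) ^ 2 * AN[3] * q₀⁻¹ * AN[2]) ^ 2) *
        ‖J‖ ^ 2 := by
  have hj' : j ≤ (P₀).m + (P₀).K := Nat.le_of_succ_le hj
  have hLpos : (0 : ℝ) < L := Nat.cast_pos.2 (Nat.pos_of_ne_zero (NeZero.ne L))
  -- no `set`/abbreviations in the goal: definitional unfolding of the kernel constants and of `‖·‖` is expensive
  have hN0 : 0 < ((L : ℝ) ^ j) ^ (d + 1) := by positivity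
  have hw : ∀ i, 0 < w i := fun i => lt_of_lt_of_le (by positivity) (hw0 i)
  have hLat := isLattice Λ' hc hj hw
  have hPos := positive Λ' hc hj w
  -- the factors of the constants are non-negative
  have hκN : 0 < kappaN (d + 1) / (d + 1) := div_pos (kappaN_pos _) (by positivity)
  have hκ163 : 0 < kappa163 (d + 1) / (d + 1) := div_pos (kappa163_pos _) (by positivity)
  have hK1 : 0 ≤ latticeConst (d + 1) (kappaN (d + 1) / (d + 1)) := latticeConst_nonneg _ hκN.le
  have hK2 : 0 ≤ latticeConst (d + 1) (kappa163 (d + 1) / (d + 1)) := latticeConst_nonneg _ hκ163.le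
  have hP1 : 0 < periodConst (kappaN (d + 1)) d := periodConst_pos (kappaN_pos _) _
  have hP2 : 0 < periodConst (kappa163 (d + 1)) d := periodConst_pos (kappa163_pos _) _
  have hM2 : 0 ≤ MGHD (d + 1) 2 := MGHD_nonneg _ _
  have hM3 : 0 ≤ MGHD (d + 1) 3 := MGHD_nonneg _ _
  have hMG : 0 ≤ MG163 (d + 1) := MG163_nonneg _
  have hCD : 0 ≤ CdecD d := CdecD_nonneg (d := d)
  have hq0 : 0 < q₀ := mul_pos (c0_2109_pos _) (by positivity)
  have hγ0 : 0 < gammaZero (d + 1) 1 := gammaZero_pos _ _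
  have hm0 : 0 < min a₀ 1 := lt_min ha₀ one_pos
  obtain ⟨s₁, hs₁0, hs1⟩ : ∃ s : ℝ, 0 ≤ s ∧ s ^ 2 = (d + 1 : ℝ) := ⟨Real.sqrt _, Real.sqrt_nonneg _, Real.sq_sqrt (by positivity)⟩
  obtain ⟨s₂, hs₂0, hs2⟩ : ∃ s : ℝ, 0 ≤ s ∧ s ^ 2 = ((L : ℝ) ^ j) ^ (d + 1) := ⟨Real.sqrt _, Real.sqrt_nonneg _, Real.sq_sqrt hN0.le⟩
  have hadj : LinearMap.adjoint Df[lam] = Db[lam] := adjoint_Dop (P := P₀) ((L : ℝ) ^ j) lam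
  -- `Y₁`: `H′_j*∂*∇_λ*J = (∇_λ∂H′_j)*J`
  have hX₁ : ∀ μ, ‖(Df[lam] ∘ₗ ((tsV1 hc Λ' w).grad ∘ₗ (tsV1 hc Λ' w).hP)) μ‖ ≤ s₁ * AN[2] * s₂ * ‖μ‖ := by
    intro μ
    refine le_of_sq_le_sq ?_ (by positivity)
    calc ‖(Df[lam] ∘ₗ ((tsV1 hc Λ' w).grad ∘ₗ (tsV1 hc Λ' w).hP)) μ‖ ^ 2 ≤ (d + 1 : ℝ) * (AN[2] ^ 2 * ((L : ℝ) ^ j) ^ (d + 1) * ‖μ‖ ^ 2) :=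
          norm_DgradHp_sq_le hc hj Λ' lam μ
      _ = (s₁ * AN[2] * s₂ * ‖μ‖) ^ 2 := by
          have e : (s₁ * AN[2] * s₂ * ‖μ‖) ^ 2 = s₁ ^ 2 * AN[2] ^ 2 * s₂ ^ 2 * ‖μ‖ ^ 2 := by ring
          rw [e, hs1, hs2]; ring
  have hy : ‖LinearMap.adjoint (tsV1 hc Λ' w).hP ((tsV1 hc Λ' w).dv (Db[lam] J))‖ ≤ s₁ * AN[2] * s₂ * ‖J‖ := by
    have e : LinearMap.adjoint (tsV1 hc Λ' w).hP ((tsV1 hc Λ' w).dv (Db[lam] J)) =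
        LinearMap.adjoint (Df[lam] ∘ₗ ((tsV1 hc Λ' w).grad ∘ₗ (tsV1 hc Λ' w).hP)) J := by
      rw [LinearMap.adjoint_comp, LinearMap.adjoint_comp, hadj, LinearMap.comp_apply, LinearMap.comp_apply, ← dv_eq_adjoint_grad hLat]
    rw [e]
    exact norm_adjoint_le _ (by positivity) hX₁ J
  -- `Y_H`: `H_j*∇_λ*J = (∇_λH_j)*J`
  have hXD : ∀ b, ‖(Df[lam] ∘ₗ (tsV1 hc Λ' w).Hj) b‖ ≤ (d + 1 : ℝ) * AD₀ * s₂ * ‖b‖ := by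
    intro b
    refine le_of_sq_le_sq ?_ (by positivity)
    calc ‖(Df[lam] ∘ₗ (tsV1 hc Λ' w).Hj) b‖ ^ 2 ≤ ((d + 1 : ℝ) * AD₀) ^ 2 * ((L : ℝ) ^ j) ^ (d + 1) * ‖b‖ ^ 2 := norm_DHj_sq_le hc hj Λ' hw lam b
      _ = ((d + 1 : ℝ) * AD₀ * s₂ * ‖b‖) ^ 2 := by
          have e : ((d + 1 : ℝ) * AD₀ * s₂ * ‖b‖) ^ 2 = ((d + 1 : ℝ) * AD₀) ^ 2 * s₂ ^ 2 * ‖b‖ ^ 2 := by ring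
          rw [e, hs2]
  have hHu : ‖LinearMap.adjoint (tsV1 hc Λ' w).Hj (Db[lam] J)‖ ≤ (d + 1 : ℝ) * AD₀ * s₂ * ‖J‖ := by
    have e : LinearMap.adjoint (tsV1 hc Λ' w).Hj (Db[lam] J) = LinearMap.adjoint (Df[lam] ∘ₗ (tsV1 hc Λ' w).Hj) J := by
      rw [LinearMap.adjoint_comp, hadj, LinearMap.comp_apply]
    rw [e]
    exact norm_adjoint_le _ (by positivity) hXD J
  -- `Y_G`
  have hGu : ⟪Db[lam] J, (tsV1 hc Λ' w).Gt (Db[lam] J)⟫_ℝ ≤ (gammaZero (d + 1) 1)⁻¹ * ‖J‖ ^ 2 := inner_Gt_Dadj_le (P := P₀) hc hj Λ' hw lam J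
  -- the five global numbers (gen 13)
  have h₃ : ∀ μ, ‖(tsV1 hc Λ' w).grad ((tsV1 hc Λ' w).lap ((tsV1 hc Λ' w).hP μ))‖ ≤ (d + 1 : ℝ) * s₁ * AN[3] * s₂ * ‖μ‖ := by
    intro μ
    have h := norm_dE_lapE_hP_sq_le hc hj' μ
    rw [div_self hc, one_pow, one_mul] at h
    refine le_of_sq_le_sq ?_ (by positivity)
    calc ‖(tsV1 hc Λ' w).grad ((tsV1 hc Λ' w).lap ((tsV1 hc Λ' w).hP μ))‖ ^ 2 ≤ (d + 1 : ℝ) ^ 3 * (AN[3] ^ 2 * ((L : ℝ) ^ j) ^ (d + 1) * ‖μ‖ ^ 2) := h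
      _ = ((d + 1 : ℝ) * s₁ * AN[3] * s₂ * ‖μ‖) ^ 2 := by
          have e : ((d + 1 : ℝ) * s₁ * AN[3] * s₂ * ‖μ‖) ^ 2 = (d + 1 : ℝ) ^ 2 * s₁ ^ 2 * AN[3] ^ 2 * s₂ ^ 2 * ‖μ‖ ^ 2 := by ring
          rw [e, hs1, hs2]; ring
  have hH : ∀ b, ‖(tsV1 hc Λ' w).Hj b‖ ≤ (d + 1 : ℝ) * AH₀ * s₂ * ‖b‖ := by
    intro b
    refine le_of_sq_le_sq ?_ (by positivity)
    calc ‖(tsV1 hc Λ' w).Hj b‖ ^ 2 ≤ ((d + 1 : ℝ) * AH₀) ^ 2 * ((L : ℝ) ^ j) ^ (d + 1) * ‖b‖ ^ 2 := norm_Hj_sq_le hc hj Λ' hw b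
      _ = ((d + 1 : ℝ) * AH₀ * s₂ * ‖b‖) ^ 2 := by
          have e : ((d + 1 : ℝ) * AH₀ * s₂ * ‖b‖) ^ 2 = ((d + 1 : ℝ) * AH₀) ^ 2 * s₂ ^ 2 * ‖b‖ ^ 2 := by ring
          rw [e, hs2]
  have hC : ∀ v, ⟪v, (tsV1 hc Λ' w).C v⟫_ℝ ≤ (((L : ℝ) ^ j) ^ (d + 1) * q₀)⁻¹ * ‖v‖ ^ 2 := by
    intro v
    have h := inner_C_le_V1' hc hj Λ' hw v
    dsimp only at h
    rw [div_self hc, one_pow, one_mul] at h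
    exact h
  have hG : ∀ x, ⟪x, (tsV1 hc Λ' w).Gt x⟫_ℝ ≤ (gammaZero (d + 1) 1)⁻¹ * ‖x‖ ^ 2 := fun x => inner_Gt_le hc hj Λ' hw x
  have hCt : ∀ b, ⟪b, (tsV1 hc Λ' w).Ct b⟫_ℝ ≤ (min a₀ 1 * ((L : ℝ) ^ j) ^ (d + 1) * Γ₀)⁻¹ * ‖b‖ ^ 2 := by
    intro b
    have h := inner_Ct_le_V1 hc hj Λ' hw (w₀ := a₀ * ((L : ℝ) ^ j) ^ (d + 1)) (by positivity) hw0 b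
    have hκ : ((L : ℝ) ^ j) ^ 2 / (eta L j ^ (d + 1) * ((L : ℝ) ^ j) ^ 2) = ((L : ℝ) ^ j) ^ (d + 1) := by
      have hx : (((L : ℝ) ^ j) ^ 2) ≠ 0 := pow_ne_zero _ hc
      have hx' : (((L : ℝ) ^ j) ^ (d + 1)) ≠ 0 := pow_ne_zero _ hc
      rw [eta, inv_pow, div_eq_iff (mul_ne_zero (inv_ne_zero hx') hx), ← mul_assoc, mul_inv_cancel₀ hx', one_mul]
    have hmin : min (a₀ * ((L : ℝ) ^ j) ^ (d + 1)) (((L : ℝ) ^ j) ^ 2 / (eta L j ^ (d + 1) * ((L : ℝ) ^ j) ^ 2)) = min a₀ 1 * ((L : ℝ) ^ j) ^ (d + 1) := by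
      rw [hκ, min_mul_of_nonneg _ _ hN0.le, one_mul]
    have hP2 : ‖(tsV1 hc Λ' w).Ax.starProjection b‖ ^ 2 ≤ ‖b‖ ^ 2 :=
      pow_le_pow_left₀ (norm_nonneg _) (Submodule.norm_starProjection_apply_le _ b) 2
    dsimp only at h
    rw [hmin] at h
    push_cast at h
    refine h.trans ?_
    exact mul_le_mul_of_nonneg_left hP2 (by positivity)
  have hmain := inner_G_le_of_bounds_at hLat hPos (Db[lam] J) (Y₁ := s₁ * AN[2] * s₂ * ‖J‖) (YH := (d + 1 : ℝ) * AD₀ * s₂ * ‖J‖)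
    (YG := (gammaZero (d + 1) 1)⁻¹ * ‖J‖ ^ 2) (X₃ := (d + 1 : ℝ) * s₁ * AN[3] * s₂) (XH := (d + 1 : ℝ) * AH₀ * s₂)
    (XC := (((L : ℝ) ^ j) ^ (d + 1) * q₀)⁻¹) (XG := (gammaZero (d + 1) 1)⁻¹) (XCt := (min a₀ 1 * ((L : ℝ) ^ j) ^ (d + 1) * Γ₀)⁻¹)
    (by positivity) (by positivity) (by positivity) (by positivity) (by positivity) hy hHu hGu h₃ hH hC hG hCt
  refine hmain.trans (le_of_eq ?_)
  have e : (((L : ℝ) ^ j) ^ (d + 1) * q₀)⁻¹ * (s₁ * AN[2] * s₂ * ‖J‖) ^ 2 +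
        2 * ((gammaZero (d + 1) 1)⁻¹ * ‖J‖ ^ 2 + (min a₀ 1 * ((L : ℝ) ^ j) ^ (d + 1) * Γ₀)⁻¹ * ((d + 1 : ℝ) * AD₀ * s₂ * ‖J‖) ^ 2) +
        2 * ((gammaZero (d + 1) 1)⁻¹ + ((d + 1 : ℝ) * AH₀ * s₂) ^ 2 * (min a₀ 1 * ((L : ℝ) ^ j) ^ (d + 1) * Γ₀)⁻¹) *
          ((d + 1 : ℝ) * s₁ * AN[3] * s₂ * (((L : ℝ) ^ j) ^ (d + 1) * q₀)⁻¹ * (s₁ * AN[2] * s₂ * ‖J‖)) ^ 2 =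
      ((((L : ℝ) ^ j) ^ (d + 1) * q₀)⁻¹ * (s₁ ^ 2 * AN[2] ^ 2 * s₂ ^ 2) +
        2 * ((gammaZero (d + 1) 1)⁻¹ + (min a₀ 1 * ((L : ℝ) ^ j) ^ (d + 1) * Γ₀)⁻¹ * ((d + 1 : ℝ) ^ 2 * AD₀ ^ 2 * s₂ ^ 2)) +
        2 * ((gammaZero (d + 1) 1)⁻¹ + (d + 1 : ℝ) ^ 2 * AH₀ ^ 2 * s₂ ^ 2 * (min a₀ 1 * ((L : ℝ) ^ j) ^ (d + 1) * Γ₀)⁻¹) *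
          ((d + 1 : ℝ) * s₁ ^ 2 * s₂ ^ 2 * AN[3] * AN[2] * (((L : ℝ) ^ j) ^ (d + 1) * q₀)⁻¹) ^ 2) * ‖J‖ ^ 2 := by ring
  rw [e, hs1, hs2]
  congr 1
  field_simp

end Concrete

section Uniform

/-- **PROPOSITION 2.5, THE GLOBAL `L²` MEMBERS `‖∇GJ‖, ‖G∇*J‖, ‖∇G∇*J‖` OF (1.89)/(1.115) FOR THE TWO-SCALE `G`, UNIFORMLY**: for every `d + 1`, `L`,
`a₀ > 0` there is `C` (depending on these only) such that for every volume `(m, K)`, every `j + 1 ≤ m + K`, every `Λ′ ⊂ T^{(j+1)}`, all weights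
`a ≥ a₀n^{d+1}` on `𝔅`, all directions `λ, μ` and every `J`: `⟨J, GJ⟩ ≤ C‖J‖²` (gen 13), `⟨∇_λ*J, G∇_λ*J⟩ ≤ C‖J‖²`, `‖∇_μG∇_λ*J‖ ≤ C‖J‖`,
`‖∇_μGJ‖ ≤ C‖J‖`, `‖G∇_λ*J‖ ≤ C‖J‖` (`G = G* ≥ 0`: Cauchy–Schwarz twice, with `prop25_inner_GDadj_le_V1` and gen 13's `prop25_inner_G_le_V1`;
`C = max(C₀, C₁)`).
[cite: Balaban1984PropagatorsII, Prop. 2.5 p.246; Balaban1984PropagatorsI, (1.89) p.33, (1.115) p.36] -/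
theorem prop25_grad_l2_bounded_uniform (d L : ℕ) [NeZero L] (hd : 1 ≤ d + 1) (hL : Odd L ∧ 1 < L) {a₀ : ℝ} (ha₀ : 0 < a₀) :
    ∃ C : ℝ, 0 ≤ C ∧ ∀ (m K j : ℕ) (hc : ((L : ℝ) ^ j) ≠ 0) (hj : j + 1 ≤ (P₀).m + (P₀).K) (Λ' : Finset (Site P₀ (j + 1)))
      (w : CIdx j Λ' → ℝ) (_ : ∀ i, a₀ * ((L : ℝ) ^ j) ^ (d + 1) ≤ w i) (lam μ : Fin (d + 1)) (J : BondSpace P₀),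
      ⟪J, (tsV1 hc Λ' w).G J⟫_ℝ ≤ C * ‖J‖ ^ 2 ∧ ⟪Db[lam] J, (tsV1 hc Λ' w).G (Db[lam] J)⟫_ℝ ≤ C * ‖J‖ ^ 2 ∧
        ‖Df[μ] ((tsV1 hc Λ' w).G (Db[lam] J))‖ ≤ C * ‖J‖ ∧ ‖Df[μ] ((tsV1 hc Λ' w).G J)‖ ≤ C * ‖J‖ ∧ ‖(tsV1 hc Λ' w).G (Db[lam] J)‖ ≤ C * ‖J‖ := by
  -- the two explicit constants
  set C₀ : ℝ := (d + 1 : ℝ) * AN[1] ^ 2 * q₀⁻¹ + ((gammaZero (d + 1) 1)⁻¹ + ((d + 1 : ℝ) * AH₀) ^ 2 * (min a₀ 1 * Γ₀)⁻¹) *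
      (1 + (d + 1 : ℝ) ^ 2 * AN[1] * AN[3] * q₀⁻¹) ^ 2 with hC₀
  set C₁ : ℝ := q₀⁻¹ * ((d + 1 : ℝ) * AN[2] ^ 2) + 2 * ((gammaZero (d + 1) 1)⁻¹ + (min a₀ 1 * Γ₀)⁻¹ * ((d + 1 : ℝ) * AD₀) ^ 2) +
      2 * ((gammaZero (d + 1) 1)⁻¹ + ((d + 1 : ℝ) * AH₀) ^ 2 * (min a₀ 1 * Γ₀)⁻¹) * ((d + 1 : ℝ) ^ 2 * AN[3] * q₀⁻¹ * AN[2]) ^ 2 with hC₁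
  have hLpos : (0 : ℝ) < L := Nat.cast_pos.2 (Nat.pos_of_ne_zero (NeZero.ne L))
  have hκN : 0 < kappaN (d + 1) / (d + 1) := div_pos (kappaN_pos _) (by positivity)
  have hκ163 : 0 < kappa163 (d + 1) / (d + 1) := div_pos (kappa163_pos _) (by positivity)
  have hK1 : 0 ≤ latticeConst (d + 1) (kappaN (d + 1) / (d + 1)) := latticeConst_nonneg _ hκN.le
  have hK2 : 0 ≤ latticeConst (d + 1) (kappa163 (d + 1) / (d + 1)) := latticeConst_nonneg _ hκ163.le
  have hP1 : 0 < periodConst (kappaN (d + 1)) d := periodConst_pos (kappaN_pos _) _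
  have hP2 : 0 < periodConst (kappa163 (d + 1)) d := periodConst_pos (kappa163_pos _) _
  have hM1 : 0 ≤ MGHD (d + 1) 1 := MGHD_nonneg _ _
  have hM2 : 0 ≤ MGHD (d + 1) 2 := MGHD_nonneg _ _
  have hM3 : 0 ≤ MGHD (d + 1) 3 := MGHD_nonneg _ _
  have hMG : 0 ≤ MG163 (d + 1) := MG163_nonneg _
  have hCD : 0 ≤ CdecD d := CdecD_nonneg (d := d)
  have hq0 : 0 < q₀ := mul_pos (c0_2109_pos _) (by positivity)
  have hγ0 : 0 < gammaZero (d + 1) 1 := gammaZero_pos _ _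
  have hm0 : 0 < min a₀ 1 := lt_min ha₀ one_pos
  have hC₀0 : 0 ≤ C₀ := by positivity
  have hC₁0 : 0 ≤ C₁ := by positivity
  refine ⟨max C₀ C₁, le_max_of_le_left hC₀0, fun m K j hc hj Λ' w hw0 lam μ J => ?_⟩
  have hw : ∀ i, 0 < w i := fun i => lt_of_lt_of_le (by positivity) (hw0 i)
  have hLat := isLattice Λ' hc hj hw
  have hPos := positive Λ' hc hj w
  have hGs : ∀ x y, ⟪(tsV1 hc Λ' w).G x, y⟫_ℝ = ⟪x, (tsV1 hc Λ' w).G y⟫_ℝ := G_symm hLat hPos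
  have hG0 : ∀ x, 0 ≤ ⟪x, (tsV1 hc Λ' w).G x⟫_ℝ := inner_G_nonneg hLat hPos
  -- the two form bounds
  have hF₀ : ∀ J', ⟪J', (tsV1 hc Λ' w).G J'⟫_ℝ ≤ C₀ * ‖J'‖ ^ 2 := fun J' => prop25_inner_G_le_V1 hc hj Λ' ha₀ hw0 J'
  have hF₁ : ∀ (ν : Fin (d + 1)) J', ⟪Db[ν] J', (tsV1 hc Λ' w).G (Db[ν] J')⟫_ℝ ≤ C₁ * ‖J'‖ ^ 2 :=
    fun ν J' => prop25_inner_GDadj_le_V1 hc hj Λ' ha₀ hw0 ν J'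
  -- in the shape of §1: `⟨∇_ν*y, G∇_ν*y⟩ ≤ C₁‖y‖²` with `∇_ν* = (∇_ν)*`, and `T = I`
  have hT : ∀ (ν : Fin (d + 1)) (y : BondSpace P₀),
      ⟪LinearMap.adjoint Df[ν] y, (tsV1 hc Λ' w).G (LinearMap.adjoint Df[ν] y)⟫_ℝ ≤ C₁ * ‖y‖ ^ 2 := fun ν y => by
    rw [adjoint_Dop]; exact hF₁ ν y
  have hT0 : ∀ y : BondSpace P₀, ⟪LinearMap.adjoint (LinearMap.id : BondSpace P₀ →ₗ[ℝ] BondSpace P₀) y,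
      (tsV1 hc Λ' w).G (LinearMap.adjoint (LinearMap.id : BondSpace P₀ →ₗ[ℝ] BondSpace P₀) y)⟫_ℝ ≤ C₀ * ‖y‖ ^ 2 := fun y => by
    rw [LinearMap.adjoint_id, LinearMap.id_apply]; exact hF₀ y
  have h1 := hF₁ lam J
  have h2 := norm_sq_apply_le_of_forms (tsV1 hc Λ' w).G hGs hG0 Df[μ] hC₁0 _ h1 (hT μ)
  have h3 := norm_sq_apply_le_of_forms (tsV1 hc Λ' w).G hGs hG0 Df[μ] hC₁0 _ (hF₀ J) (hT μ)
  have h4 := norm_sq_apply_le_of_forms (tsV1 hc Λ' w).G hGs hG0 LinearMap.id hC₀0 _ h1 hT0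
  rw [LinearMap.id_apply] at h4
  -- `t² ≤ X‖J‖²·Y`, `X, Y ≤ max(C₀, C₁)` ⇒ `t ≤ max(C₀, C₁)‖J‖`
  have key : ∀ {t X Y : ℝ}, 0 ≤ t → 0 ≤ X → X ≤ max C₀ C₁ → Y ≤ max C₀ C₁ → t ^ 2 ≤ X * ‖J‖ ^ 2 * Y → t ≤ max C₀ C₁ * ‖J‖ := by
    intro t X Y ht hX0 hX hY h
    refine le_of_sq_le_sq ?_ (by positivity)
    calc t ^ 2 ≤ X * ‖J‖ ^ 2 * Y := h
      _ ≤ max C₀ C₁ * ‖J‖ ^ 2 * max C₀ C₁ := by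
          by_cases hY0 : 0 ≤ Y
          · exact mul_le_mul (mul_le_mul_of_nonneg_right hX (sq_nonneg _)) hY hY0 (by positivity)
          · exact (mul_nonpos_iff.mpr (Or.inl ⟨by positivity, (not_le.mp hY0).le⟩)).trans (by positivity)
      _ = (max C₀ C₁ * ‖J‖) ^ 2 := by ring
  refine ⟨(hF₀ J).trans (mul_le_mul_of_nonneg_right (le_max_left _ _) (sq_nonneg _)),
    h1.trans (mul_le_mul_of_nonneg_right (le_max_right _ _) (sq_nonneg _)), ?_, ?_, ?_⟩
  · exact key (norm_nonneg _) hC₁0 (le_max_right _ _) (le_max_right _ _) h2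
  · exact key (norm_nonneg _) hC₀0 (le_max_left _ _) (le_max_right _ _) h3
  · exact key (norm_nonneg _) hC₁0 (le_max_right _ _) (le_max_left _ _) h4

/-- **[4] (1.90) `Δ_a = G⁻¹ ≥ γ(Δ + I)` FOR THE TWO-SCALE `Δ_a` OF (2.90), UNIFORMLY** (the printed consequence of (1.89)): with the constant `C` of
`prop25_grad_l2_bounded_uniform`, for every volume, `j`, `Λ′`, weights `a ≥ a₀n^{d+1}`, direction `μ` and vector field `A`:
`‖∇_μA‖² ≤ C⟨A, Δ_aA⟩` and `‖A‖² ≤ C⟨A, Δ_aA⟩` (`A = G(Δ_aA)`, Cauchy–Schwarz for the form of `G`: `‖∇_μA‖⁴ = ⟨Δ_aA, G∇_μ*∇_μA⟩² ≤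
⟨A, Δ_aA⟩·⟨∇_μ*∇_μA, G∇_μ*∇_μA⟩ ≤ ⟨A, Δ_aA⟩·C‖∇_μA‖²`). [cite: Balaban1984PropagatorsI, (1.90) p.33; Balaban1984PropagatorsII, Prop. 2.5 p.246] -/
theorem prop25_ineq190_uniform (d L : ℕ) [NeZero L] (hd : 1 ≤ d + 1) (hL : Odd L ∧ 1 < L) {a₀ : ℝ} (ha₀ : 0 < a₀) :
    ∃ C : ℝ, 0 ≤ C ∧ ∀ (m K j : ℕ) (hc : ((L : ℝ) ^ j) ≠ 0) (hj : j + 1 ≤ (P₀).m + (P₀).K) (Λ' : Finset (Site P₀ (j + 1)))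
      (w : CIdx j Λ' → ℝ) (_ : ∀ i, a₀ * ((L : ℝ) ^ j) ^ (d + 1) ≤ w i) (μ : Fin (d + 1)) (A : BondSpace P₀),
      ‖Df[μ] A‖ ^ 2 ≤ C * ⟪A, (tsV1 hc Λ' w).deltaA A⟫_ℝ ∧ ‖A‖ ^ 2 ≤ C * ⟪A, (tsV1 hc Λ' w).deltaA A⟫_ℝ := by
  obtain ⟨C, hC0, hC⟩ := prop25_grad_l2_bounded_uniform d L hd hL ha₀
  refine ⟨C, hC0, fun m K j hc hj Λ' w hw0 μ A => ?_⟩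
  have hLpos : (0 : ℝ) < L := Nat.cast_pos.2 (Nat.pos_of_ne_zero (NeZero.ne L))
  have hw : ∀ i, 0 < w i := fun i => lt_of_lt_of_le (by positivity) (hw0 i)
  have hLat := isLattice Λ' hc hj hw
  have hPos := positive Λ' hc hj w
  have hGs : ∀ x y, ⟪(tsV1 hc Λ' w).G x, y⟫_ℝ = ⟪x, (tsV1 hc Λ' w).G y⟫_ℝ := G_symm hLat hPos
  have hG0 : ∀ x, 0 ≤ ⟪x, (tsV1 hc Λ' w).G x⟫_ℝ := inner_G_nonneg hLat hPos
  have hGv : (tsV1 hc Λ' w).G ((tsV1 hc Λ' w).deltaA A) = A := by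
    have h := LinearMap.congr_fun (G_comp_deltaA hLat hPos) A
    rwa [LinearMap.comp_apply, LinearMap.id_apply] at h
  have hvv : ⟪(tsV1 hc Λ' w).deltaA A, (tsV1 hc Λ' w).G ((tsV1 hc Λ' w).deltaA A)⟫_ℝ = ⟪A, (tsV1 hc Λ' w).deltaA A⟫_ℝ := by
    rw [hGv, real_inner_comm]
  have hΔ0 : 0 ≤ ⟪A, (tsV1 hc Λ' w).deltaA A⟫_ℝ := nonneg_of_posDef _ (deltaA_pos hLat hPos) A
  obtain ⟨hA0, -, -, -, -⟩ := hC m K j hc hj Λ' w hw0 μ μ A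
  obtain ⟨-, hJ1, -, -, -⟩ := hC m K j hc hj Λ' w hw0 μ μ (Df[μ] A)
  constructor
  · -- `‖∇_μA‖² = ⟨Δ_aA, G∇_μ*∇_μA⟩`
    have h1 : ‖Df[μ] A‖ ^ 2 = ⟪(tsV1 hc Λ' w).deltaA A, (tsV1 hc Λ' w).G (Db[μ] (Df[μ] A))⟫_ℝ := by
      rw [← hGs, hGv, ← adjoint_Dop, LinearMap.adjoint_inner_right, real_inner_self_eq_norm_sq]
    have h2 : (‖Df[μ] A‖ ^ 2) ^ 2 ≤ ⟪A, (tsV1 hc Λ' w).deltaA A⟫_ℝ * (C * ‖Df[μ] A‖ ^ 2) :=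
      calc (‖Df[μ] A‖ ^ 2) ^ 2 = ⟪(tsV1 hc Λ' w).deltaA A, (tsV1 hc Λ' w).G (Db[μ] (Df[μ] A))⟫_ℝ ^ 2 := by rw [← h1]
        _ ≤ ⟪(tsV1 hc Λ' w).deltaA A, (tsV1 hc Λ' w).G ((tsV1 hc Λ' w).deltaA A)⟫_ℝ *
              ⟪Db[μ] (Df[μ] A), (tsV1 hc Λ' w).G (Db[μ] (Df[μ] A))⟫_ℝ := inner_sq_le_of_symm_nonneg _ hGs hG0 _ _
        _ ≤ ⟪A, (tsV1 hc Λ' w).deltaA A⟫_ℝ * (C * ‖Df[μ] A‖ ^ 2) := by rw [hvv]; exact mul_le_mul_of_nonneg_left hJ1 hΔ0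
    by_cases hz : ‖Df[μ] A‖ ^ 2 = 0
    · rw [hz]; positivity
    · have hpos : 0 < ‖Df[μ] A‖ ^ 2 := lt_of_le_of_ne (sq_nonneg _) (Ne.symm hz)
      nlinarith [h2, hpos]
  · have h1 : ‖A‖ ^ 2 = ⟪(tsV1 hc Λ' w).deltaA A, (tsV1 hc Λ' w).G A⟫_ℝ := by
      rw [← hGs, hGv, real_inner_self_eq_norm_sq]
    have h2 : (‖A‖ ^ 2) ^ 2 ≤ ⟪A, (tsV1 hc Λ' w).deltaA A⟫_ℝ * (C * ‖A‖ ^ 2) :=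
      calc (‖A‖ ^ 2) ^ 2 = ⟪(tsV1 hc Λ' w).deltaA A, (tsV1 hc Λ' w).G A⟫_ℝ ^ 2 := by rw [← h1]
        _ ≤ ⟪(tsV1 hc Λ' w).deltaA A, (tsV1 hc Λ' w).G ((tsV1 hc Λ' w).deltaA A)⟫_ℝ * ⟪A, (tsV1 hc Λ' w).G A⟫_ℝ :=
              inner_sq_le_of_symm_nonneg _ hGs hG0 _ _
        _ ≤ ⟪A, (tsV1 hc Λ' w).deltaA A⟫_ℝ * (C * ‖A‖ ^ 2) := by rw [hvv]; exact mul_le_mul_of_nonneg_left hA0 hΔ0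
    by_cases hz : ‖A‖ ^ 2 = 0
    · rw [hz]; positivity
    · have hpos : 0 < ‖A‖ ^ 2 := lt_of_le_of_ne (sq_nonneg _) (Ne.symm hz)
      nlinarith [h2, hpos]

end Uniform

end Literature.MathematicalPhysics.QuantumFieldTheory.Balaban1983to89.B6Prop25GlobalGradL2TwoScaleV1
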